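/-
Copyright (c) 2026 the pub-hodgecm-mathlib formalisation cell (harness21).  Prover seat hodgecm-mathlib-K2Liu-p13 (g3), Track B «K2-LIT»,
#184♮ = hLiu418 = `stmt-HodgeConjecture-24832`; ROAD Φ (RULING «M-156n»), consumer sheet fa2b1e3a29709f09 row G6-fin — the GROWTH FACE of the big cell,
ASSEMBLED: ★ `K2LiuBigCellGrowthOfEquivariance.growth_of_equivariance_of_pointRepr` with every binder this lineage owns discharged by ★ files
(`hIw` ★ `IwasawaDatum`, `hPK` ★ `K2LiuModDeltaHeightComparison`, `hω` ★ `exists_character_bound` + ★ `norm_chiDet_eq_modDelta_rpow`, `heqv` ★∕📤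
`K2LiuIntertwiningDeltaUnconditional`, `hrep`∕`hψ`∕`hB` ★ `K2LiuPointEvaluationRepresentation`), leaving as binders exactly the two inputs of other lineages:
the continuation `hEd` of the normalised big cell and its `K`-finiteness `(V, hV)`.  THEOREMS ONLY (no `def`, no `instance`, no named-fact hypothesis, no `sorry`).
-/
import Summits.HodgeConjecture.HodgeConjecture.Theorems.K2LiuIntertwiningDeltaUnconditional        -- ★∕📤 `heqv` unconditional
import Summits.HodgeConjecture.HodgeConjecture.Theorems.K2LiuBigCellGrowthOfEquivariance          -- ★ the abstract growth theorem
import Summits.HodgeConjecture.HodgeConjecture.Theorems.K2LiuModDeltaHeightComparison             -- ★ `hPK`, `hω` suppliers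
import Summits.HodgeConjecture.HodgeConjecture.Theorems.K2LiuPointEvaluationRepresentation        -- ★ `hrep`∕`hψ`∕`hB` supplier
import Summits.HodgeConjecture.HodgeConjecture.Theorems.K2LiuDoublingSectionIntegrableReduction   -- ★ `norm_chiDet_eq_modDelta_rpow`, `|χ| = ‖·‖^σ`
import Literature.NumberTheory.K2Lit.SiegelStandardSections                                     -- ★ `IwasawaDatum`
import HarnessLib

/-!
# Crux `HLiu418`, ROAD Φ, organ Φ8 (sheet row G6-fin): THE GROWTH FACE OF THE BIG CELL, ASSEMBLED — moderate growth of the normalised intertwined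
# section `a(s)·M(s)f_s` in the height `adelicHeightGL (n+n)`, locally uniformly in `s`, from its continuation and its `K`-finiteness ALONE

Cell `hodgecm-mathlib`, crux item hLiu418 = `stmt-HodgeConjecture-24832` (helper lane, count-neutral).  GENERIC `n ≠ 0`, doubled frame `H(𝔸) = HA L e dV hdV dW hdW`.
For a family `f s` of `(P_Δ(𝔸), χ, s)`-sections, a Haar measure `νN` on `N_Δ(𝔸)`, a normalising scalar `a(s)` and `E s := a s · intertwiningDelta νN (f s)`:
IF `s ↦ E s x` is holomorphic on `{0 < re s}` for every `x` (`hEd` — the meromorphic continuation of the big cell, rows σ20∕G6 of other lineages) and the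
restrictions `E s|_K`, `0 < re s`, lie in ONE finite-dimensional space `V` of bounded functions on the Iwasawa compact `K` (`hV` — `K`-finiteness, compact-picture
lineage), THEN `‖E s x‖ ≤ C · adelicHeightGL(x)^A` locally uniformly in `s ∈ {0 < re}` (**`bigCell_growth`**) — the `hgrowth` summand of ★
`K2LiuSiegelEisensteinAssembly.exists_continuation_package_of_term_packages` for the big-cell term.  Every other input is ★: the Iwasawa decomposition
(`𝒦 : IwasawaDatum`, ★ nonempty), `hPK` (★ `exists_height_le_mul_height_mul`), the character bound `hω` for `ω s p = χ′_det(p)·modDelta(p)^{n−2s}`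
(★ `exists_character_bound`, ★ `norm_chiDet_eq_modDelta_rpow`, ★ `HeckeCharacter.exists_norm_apply_eq_ideleNorm_rpow`), the equivariance `heqv`
(★ `intertwiningDelta_family_equivariant_of_conj`, i.e. (MOD) + (WCHAR)), and the point-evaluation representation (★ `exists_pointRepr_family`).
Sources: [Garrett2018, §3.10–§3.12]; [MoeglinWaldspurger1995, I.2.17, II.1.6, IV.1]; [HarrisKudlaSweet1996, §6]; [KudlaSweet1997, §1].
HONEST LABEL.  Helper lemmas, count-neutral; `HC_CM` is proved only modulo the 7 printed citations (2 remaining named inputs: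
hLiu418 = `stmt-HodgeConjecture-24832`, h413 = `stmt-HodgeConjecture-24833`) until rung 0 closes.
-/

set_option autoImplicit false
set_option linter.dupNamespace false -- the mandated namespace repeats `HodgeConjecture.HodgeConjecture`

noncomputable section

open scoped Matrix NNReal ENNReal
open NumberField IsDedekindDomain MeasureTheory MeasureTheory.Measure Metric

namespace Summit.HodgeConjecture.HodgeConjecture.Cruxes.HLiu418.K2LiuBigCellGrowthAssembled

open Literature.NumberTheory.GelbartRogawski1991.AdaptedBlocks
open Literature.NumberTheory.Automorphic Literature.NumberTheory.Automorphic.UnitaryGroup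
open Literature.NumberTheory.GelbartRogawski1991 Literature.NumberTheory.GelbartRogawski1991.GRConstruction
open Literature.NumberTheory.K2Lit.SiegelDoubled Literature.NumberTheory.GaloisRepresentations
open UnitaryDualPair
open Summit.HodgeConjecture.HodgeConjecture.Cruxes.HLiu418.K2LiuIntertwiningDeltaUnconditional
open Summit.HodgeConjecture.HodgeConjecture.Cruxes.HLiu418.K2LiuBigCellGrowthOfEquivariance
open Summit.HodgeConjecture.HodgeConjecture.Cruxes.HLiu418.K2LiuModDeltaHeightComparison
open Summit.HodgeConjecture.HodgeConjecture.Cruxes.HLiu418.K2LiuPointEvaluationRepresentation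
open Summit.HodgeConjecture.HodgeConjecture.Cruxes.HLiu418.K2LiuDoublingSectionIntegrableReduction (norm_chiDet_eq_modDelta_rpow)

variable (L : Type) [Field L] [NumberField L] [IsCMField L]
variable {N M n : ℕ} (e : Fin N × Fin M ≃ Fin n)
  (dV : Fin N → L) (hdV : ∀ i, IsCMField.complexConj L (dV i) = dV i)
  (dW : Fin M → L) (hdW : ∀ i, IsCMField.complexConj L (dW i) = dW i)

/-! ## §1 The ★ binders of `growth_of_equivariance_of_pointRepr` in the height `adelicHeightGL (n+n)` -/

/-- `hIw` from an Iwasawa datum: `H(𝔸) = P_Δ(𝔸)·K`. [cite: MoeglinWaldspurger1995, I.1.4] [cite: Tan1999, §1] -/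
theorem hIw_of_iwasawaDatum (𝒦 : IwasawaDatum L e dV hdV dW hdW) :
    ∀ x : HA L e dV hdV dW hdW, ∃ p ∈ {p : HA L e dV hdV dW hdW | IsSiegelDelta L e dV hdV dW hdW p}, ∃ k ∈ (𝒦.K : Set (HA L e dV hdV dW hdW)), x = p * k :=
  fun x => by
    obtain ⟨p, k, hp, hk, hx⟩ := 𝒦.iwasawa x
    exact ⟨p, hp, k, hk, hx⟩

/-- `hPK` in the height `adelicHeightGL (n+n)`: `H(p) ≤ C_K · H(p k)` for `k` in the compact `K` (★ `exists_height_le_mul_height_mul`).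
[cite: MoeglinWaldspurger1995, I.2.2] -/
theorem exists_hPK {K : Set (HA L e dV hdV dW hdW)} (hK : IsCompact K) :
    ∃ CK : ℝ, 0 ≤ CK ∧ ∀ p ∈ {p : HA L e dV hdV dW hdW | IsSiegelDelta L e dV hdV dW hdW p}, ∀ k ∈ K,
      adelicHeightGL (n + n) L (p : GL (Fin (n + n)) (AdeleRing (𝓞 L) L)) ≤
        CK * adelicHeightGL (n + n) L ((p * k : HA L e dV hdV dW hdW) : GL (Fin (n + n)) (AdeleRing (𝓞 L) L)) := by
  obtain ⟨CK, hCK, h⟩ := exists_height_le_mul_height_mul (K := L) (N := n + n) (hK.image continuous_subtype_val)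
  exact ⟨CK, hCK, fun p _ k hk => by simpa only [Subgroup.coe_mul] using h _ _ (Set.mem_image_of_mem _ hk)⟩

/-- the norm of the intertwined character: `‖χ′_det(p) · modDelta(p)^{n−2s}‖ = ‖modDelta(p)^{(n+2σ′)−2s}‖` when `|χ′| = ‖·‖^{σ′}`.
[cite: WeilBNT1967, Ch. VII §3] -/
theorem norm_omega_eq (χ' : HeckeCharacter L) {σ' : ℝ} (hσ' : ∀ x : ideleGroup L, ‖((χ' x : ℂˣ) : ℂ)‖ = ideleNorm x ^ σ') (s : ℂ)
    (p : HA L e dV hdV dW hdW) :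
    ‖((chiDet L e dV hdV dW hdW χ' p : ℂˣ) : ℂ) * ((modDelta L e dV hdV dW hdW p : ℝ) : ℂ) ^ (((n : ℝ) : ℂ) - 2 * s)‖ =
      ‖(1 : ℂ) * ((modDelta L e dV hdV dW hdW p : ℝ) : ℂ) ^ ((((n : ℝ) + 2 * σ' : ℝ) : ℂ) - 2 * s)‖ := by
  have hm := modDelta_pos L e dV hdV dW hdW p
  rw [norm_mul, norm_mul, norm_one, one_mul, norm_chiDet_eq_modDelta_rpow L e dV hdV dW hdW χ' hσ' p,
    Complex.norm_cpow_eq_rpow_re_of_pos hm, Complex.norm_cpow_eq_rpow_re_of_pos hm, ← Real.rpow_add hm]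
  congr 1
  simp only [Complex.sub_re, Complex.ofReal_re, Complex.mul_re, Complex.re_ofNat, Complex.im_ofNat]
  ring

/-- `hω` for the intertwined character `ω s p = χ′_det(p) · modDelta(p)^{n−2s}` in the height `adelicHeightGL (n+n)` (★ `exists_character_bound`).
[cite: MoeglinWaldspurger1995, II.1.6] [cite: HarrisKudlaSweet1996, §6] -/
theorem hω_chiDet_modDelta [NeZero n] (χ' : HeckeCharacter L) :
    ∀ z : ℂ, 0 < z.re → ∃ C A ρ : ℝ, 0 ≤ C ∧ 0 ≤ A ∧ 0 < ρ ∧ ∀ s : ℂ, dist s z < ρ →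
      ∀ p ∈ {p : HA L e dV hdV dW hdW | IsSiegelDelta L e dV hdV dW hdW p},
        ‖((chiDet L e dV hdV dW hdW χ' p : ℂˣ) : ℂ) * ((modDelta L e dV hdV dW hdW p : ℝ) : ℂ) ^ (((n : ℝ) : ℂ) - 2 * s)‖ ≤
          C * adelicHeightGL (n + n) L (p : GL (Fin (n + n)) (AdeleRing (𝓞 L) L)) ^ A := by
  obtain ⟨σ', hσ'⟩ := χ'.exists_norm_apply_eq_ideleNorm_rpow
  intro z hz
  obtain ⟨C, A, ρ, hC, hA, hρ, hb⟩ :=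
    exists_character_bound L e dV hdV dW hdW ((n : ℝ) + 2 * σ') (fun _ _ => (1 : ℂ)) (fun _ _ => by simp) z hz
  exact ⟨C, A, ρ, hC, hA, hρ, fun s hs p hp => (norm_omega_eq L e dV hdV dW hdW χ' hσ' s p).le.trans (hb s hs p hp)⟩

/-- `hωd`: `s ↦ χ′_det(p) · modDelta(p)^{n−2s}` is holomorphic (everywhere, in particular on `{0 < re}`). [folklore] -/
theorem hωd_chiDet_modDelta (χ' : HeckeCharacter L) (p : HA L e dV hdV dW hdW) (U : Set ℂ) :
    DifferentiableOn ℂ (fun s : ℂ =>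
      ((chiDet L e dV hdV dW hdW χ' p : ℂˣ) : ℂ) * ((modDelta L e dV hdV dW hdW p : ℝ) : ℂ) ^ (((n : ℝ) : ℂ) - 2 * s)) U := by
  have hne : ((modDelta L e dV hdV dW hdW p : ℝ) : ℂ) ≠ 0 := Complex.ofReal_ne_zero.2 (modDelta_pos L e dV hdV dW hdW p).ne'
  intro s _
  exact (((differentiableAt_const _).sub ((differentiableAt_id).const_mul _)).const_cpow (Or.inl hne)).const_mul _
    |>.differentiableWithinAt

/-! ## §2 The growth face of the big cell, assembled -/

/-- **THE GROWTH FACE OF THE BIG CELL, ASSEMBLED.**  `E s := a s · intertwiningDelta νN (f s)` for a family of `(P_Δ(𝔸), χ, s)`-sections `f s`, a Haar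
measure `νN` on `N_Δ(𝔸)`, `χ′ = (χ ∘ c)⁻¹` on ideles and any scalar normalisation `a`.  Binders NOT ★ (other lineages): `hEd` — `s ↦ E s x` holomorphic on
`{0 < re}` (continuation of the big cell); `V`, `hVb`, `hV` — ONE finite-dimensional space of bounded functions on the Iwasawa compact `K` containing every
`E s|_K`, `0 < re s` (`K`-finiteness).  Conclusion = the `hgrowth` summand of the big-cell term: `‖E s x‖ ≤ C · adelicHeightGL(x)^A` locally uniformly on `{0 < re}`.
[cite: Garrett2018, §3.12] [cite: MoeglinWaldspurger1995, I.2.17, IV.1] [cite: HarrisKudlaSweet1996, §6] [cite: KudlaSweet1997, §1] -/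
theorem bigCell_growth [NeZero n] (hdV0 : ∀ i, dV i ≠ 0) (hdW0 : ∀ i, dW i ≠ 0) (𝒦 : IwasawaDatum L e dV hdV dW hdW)
    [MeasurableSpace (unipDelta L e dV hdV dW hdW)] [BorelSpace (unipDelta L e dV hdV dW hdW)]
    (νN : Measure (unipDelta L e dV hdV dW hdW)) [νN.IsHaarMeasure] (χ χ' : HeckeCharacter L)
    (hχ' : ∀ u : (AdeleRing (𝓞 L) L)ˣ,
      χ' u = (χ (Units.map (conjAdele (Fp L) L (IsCMField.complexConj L) : AdeleRing (𝓞 L) L →* AdeleRing (𝓞 L) L) u))⁻¹)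
    (f : ℂ → HA L e dV hdV dW hdW → ℂ) (hf : ∀ s : ℂ, IsSiegelDeltaSection L e dV hdV dW hdW χ s (f s)) (a : ℂ → ℂ)
    (hEd : ∀ x : HA L e dV hdV dW hdW,
      DifferentiableOn ℂ (fun s : ℂ => a s * intertwiningDelta L e dV hdV dW hdW νN (f s) x) {s : ℂ | 0 < s.re})
    (V : Submodule ℂ (↥(𝒦.K : Set (HA L e dV hdV dW hdW)) → ℂ)) [FiniteDimensional ℂ V] (hVb : ∀ F ∈ V, ∃ B : ℝ, ∀ k, ‖F k‖ ≤ B)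
    (hV : ∀ s : ℂ, 0 < s.re →
      (fun k : ↥(𝒦.K : Set (HA L e dV hdV dW hdW)) => a s * intertwiningDelta L e dV hdV dW hdW νN (f s) (k : HA L e dV hdV dW hdW)) ∈ V) :
    ∀ z : ℂ, 0 < z.re → ∃ C A ρ : ℝ, 0 ≤ C ∧ 0 ≤ A ∧ 0 < ρ ∧ ∀ s : ℂ, dist s z < ρ → ∀ x : HA L e dV hdV dW hdW,
      ‖a s * intertwiningDelta L e dV hdV dW hdW νN (f s) x‖ ≤ C * adelicHeightGL (n + n) L (x : GL (Fin (n + n)) (AdeleRing (𝓞 L) L)) ^ A := by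
  classical
  obtain ⟨CK, hCK, hPK⟩ := exists_hPK L e dV hdV dW hdW (n := n) 𝒦.isCompact_K
  obtain ⟨s₀, ψ, B, hB, hψ, hrep⟩ := exists_pointRepr_family (𝒦.K : Set (HA L e dV hdV dW hdW)) V hVb
    (fun s x => a s * intertwiningDelta L e dV hdV dW hdW νN (f s) x) hV
  exact growth_of_equivariance_of_pointRepr (hIw_of_iwasawaDatum L e dV hdV dW hdW 𝒦)
    (fun x : HA L e dV hdV dW hdW => adelicHeightGL (n + n) L (x : GL (Fin (n + n)) (AdeleRing (𝓞 L) L))) (fun _ => adelicHeightGL_nonneg _)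
    hCK hPK (fun p _ => hωd_chiDet_modDelta L e dV hdV dW hdW χ' p _) (hω_chiDet_modDelta L e dV hdV dW hdW χ') hEd le_rfl
    (intertwiningDelta_family_equivariant_of_conj L e dV hdV dW hdW hdV0 hdW0 νN χ χ' hχ' 0 f hf a)
    (kpt := fun i : ↥s₀ => ((i : ↥(𝒦.K : Set (HA L e dV hdV dW hdW))) : HA L e dV hdV dW hdW)) hrep hB hψ

/-- the same in the `hgrowth` BYTE SHAPE of ★ `exists_continuation_package_of_term_packages` for a ONE-TERM family (`∃ C A r, 0 < r ∧ …`, no sign clauses).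
[cite: Garrett2018, §3.12] [cite: KudlaSweet1997, §1] -/
theorem bigCell_growth' [NeZero n] (hdV0 : ∀ i, dV i ≠ 0) (hdW0 : ∀ i, dW i ≠ 0) (𝒦 : IwasawaDatum L e dV hdV dW hdW)
    [MeasurableSpace (unipDelta L e dV hdV dW hdW)] [BorelSpace (unipDelta L e dV hdV dW hdW)]
    (νN : Measure (unipDelta L e dV hdV dW hdW)) [νN.IsHaarMeasure] (χ χ' : HeckeCharacter L)
    (hχ' : ∀ u : (AdeleRing (𝓞 L) L)ˣ,
      χ' u = (χ (Units.map (conjAdele (Fp L) L (IsCMField.complexConj L) : AdeleRing (𝓞 L) L →* AdeleRing (𝓞 L) L) u))⁻¹)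
    (f : ℂ → HA L e dV hdV dW hdW → ℂ) (hf : ∀ s : ℂ, IsSiegelDeltaSection L e dV hdV dW hdW χ s (f s)) (a : ℂ → ℂ)
    (hEd : ∀ x : HA L e dV hdV dW hdW,
      DifferentiableOn ℂ (fun s : ℂ => a s * intertwiningDelta L e dV hdV dW hdW νN (f s) x) {s : ℂ | 0 < s.re})
    (V : Submodule ℂ (↥(𝒦.K : Set (HA L e dV hdV dW hdW)) → ℂ)) [FiniteDimensional ℂ V] (hVb : ∀ F ∈ V, ∃ B : ℝ, ∀ k, ‖F k‖ ≤ B)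
    (hV : ∀ s : ℂ, 0 < s.re →
      (fun k : ↥(𝒦.K : Set (HA L e dV hdV dW hdW)) => a s * intertwiningDelta L e dV hdV dW hdW νN (f s) (k : HA L e dV hdV dW hdW)) ∈ V) :
    ∀ z : ℂ, 0 < z.re → ∃ C A r : ℝ, 0 < r ∧ ∀ s : ℂ, dist s z < r → ∀ x : HA L e dV hdV dW hdW,
      ‖a s * intertwiningDelta L e dV hdV dW hdW νN (f s) x‖ ≤ C * adelicHeightGL (n + n) L (x : GL (Fin (n + n)) (AdeleRing (𝓞 L) L)) ^ A :=
  fun z hz => by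
    obtain ⟨C, A, ρ, -, -, hρ, h⟩ := bigCell_growth L e dV hdV dW hdW hdV0 hdW0 𝒦 νN χ χ' hχ' f hf a hEd V hVb hV z hz
    exact ⟨C, A, ρ, hρ, h⟩

end Summit.HodgeConjecture.HodgeConjecture.Cruxes.HLiu418.K2LiuBigCellGrowthAssembled

end
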